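import Mathlib.Algebra.MvPolynomial.Monad
import Mathlib.Algebra.MvPolynomial.Funext
import Mathlib.RingTheory.MvPolynomial.Basic
import Literature.Barriers.ValiantsHypothesis.AlgebraicNaturalProofs
import HarnessLib

/-!
# Algebraically natural proofs: SUCCINCT GENERATORS — the door through which hardness-randomness
# enters the barrier (Forbes–Shpilka–Volk 2018 Def. 7 / Lemma 14; Kumar–Ramya–Saptharishi–Tengse 2022)

Companion to `AlgebraicNaturalProofs.lean` (FSV Def. 1, Def. 3, Thm. 4, the hypothesis
`SuccinctHittingSetsForVP F` = FSV Question 6, and the conditional no-go). That file isolates the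
whole weight of the barrier in ONE open hypothesis; this file types the only known way of PROVING
such a hypothesis — a *succinct hitting-set generator* — over a general (infinite) field, and the
exact arrow at which the printed argument for `VNP` (KRST 2022) stops short of `VP`
(Bürgisser 2024, §7.3: "The proof does not appear to extend to VP").

**Printed sources (checked with `lit read`).**

* FSV Def. 7 (succinct generator): a polynomial map `𝒢 : 𝔽^ℓ → 𝔽^M` is a `𝒞`-succinct generator
  for `𝒟` if (2) "For every value `α ∈ 𝔽^ℓ`, the polynomial `G(x, α) ∈ 𝒞`" (where
  `G(x, y) = Σ_m 𝒢_m(y) x^m`) and (3) "`𝒢` is a generator for `𝒟`. That is, `D ∈ 𝒟` is a non-zero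
  polynomial … iff `D ∘ 𝒢 ≢ 0`"; remark after Def. 7: "Conditions (2) and (3) are equivalent, over
  large enough fields, to the property that the output of the generator … is a `𝒞`-succinct hitting
  set for `𝒟`. However, the generator result is a priori stronger". Lemma 14 (generator ⇒ succinct
  hitting set, with the interpolation count `(δΔ+1)^ℓ` over a field of size `> δΔ`); Lemma 13
  (succinct hitting set ⇒ succinct generator, via a universal circuit).
* KRST 2022, Def. 5 (hitting set generator: "for all nonzero `P ∈ 𝒞`, `P ∘ G ≢ 0`"), Lemma 8
  (Kabanets–Impagliazzo: for an `(ℓ, m, n)`-design `S_1, …, S_N` and an `m`-variate `f` requiring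
  size `s`, the map `KI-gen(f) : y ↦ (f(y_{S_1}), …, f(y_{S_N}))` is a hitting set generator for
  circuits of size `≤ s^{0.1} / (N (d+1)^n)`), §3.4–3.5 (the `VNP`-succinctness of `KI-gen(Perm)` for
  the Reed–Solomon design: the polynomial `Σ_e y^e · Perm(z_{S_e})` is in `VNP`, and "by the
  Polynomial Identity Lemma" a nonzero `P ∘ KI-gen ≢ 0` is nonzero at the coefficient vector of some
  member of `VNP(n,d)`), §1.2 and §4 ("Extending the result … to hardness of equations for VP … does
  not appear to extend"; open problem 1).

**What this file proves** (general commutative semiring / infinite field `F`; nothing unproved is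
asserted, every hypothesis is a predicate with its parameters displayed).

* `genOutput G a` — the output `(𝒢_m(a))_m` of a polynomial map `G : M → F[τ]` at a seed `a`;
  `IsHittingSetGenerator 𝒟 G` — FSV Def. 7 (3) / KRST Def. 5 (`D ≠ 0 ⇒ D ∘ G ≠ 0`, the
  composition being `MvPolynomial.bind₁ G D`); `IsSuccinctGenerator M 𝒞 G` — FSV Def. 7 (2) in
  coefficient form (every output is the `M`-coefficient vector of a member of `𝒞`).
* `isSuccinctHittingSet_of_generator` — **FSV Lemma 14 over an infinite field** (KRST §3.5's
  "Polynomial Identity Lemma" step): a succinct generator that hits `𝒟` makes `𝒞` a succinct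
  hitting set for `𝒟`; `IsHittingSetGenerator.of_hits` — the converse half of FSV's remark (any
  semiring): if the output SET hits `𝒟` then `G` is a generator.
* Relative (slice) forms for the narrowed barrier of the 2026-08-16 audit
  (`IsHittingSetGeneratorRel`, `isSuccinctHittingSetRel_of_generator`), and the `P = ⊤` sanity
  equivalence recorded there as "only the implication is proved": over an infinite field (any
  monomial set `M`), `IsSuccinctHittingSetRel M univ 𝒞 𝒟 ↔ IsSuccinctHittingSet M 𝒞 𝒟`
  (`isSuccinctHittingSetRel_univ_iff`) and `SuccinctHittingSetsForVPRel F ⊤ ↔ SuccinctHittingSetsForVP F`.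
* The asymptotic door in the tree's regime (`d = n`, `N = binom(2n, n)`): `SuccinctGeneratorsForVP F`
  (FSV Def. 7 at the parameters of Cor. 15 / Question 6: for every distinguisher level `a`, a size
  exponent `b` and, eventually in `n`, ONE polynomial map on finitely many seed variables that hits
  `Distinguishers F n a` and whose outputs are coefficient vectors of members of `SmallCircuits F n b`)
  and `succinctHittingSetsForVP_of_generators : SuccinctGeneratorsForVP F → SuccinctHittingSetsForVP F`.
* The Kabanets–Impagliazzo / Nisan–Wigderson SHAPE of KRST's generator: `designGenerator f S`, the
  map `e ↦ f(y|_{S_e})` for an `m`-variate `f` and a set system `S : M → (ρ → τ)` (coordinate `e`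
  reads `f` on the seed variables `S e`), its outputs (`genOutput_designGenerator`:
  `e ↦ f(a ∘ S_e)`), and the unfolding of its succinctness (`isSuccinctGenerator_designGenerator_iff`):
  **`𝒞`-succinctness of `KI-gen(f)` says exactly that for every seed `a` the polynomial
  `Σ_{e ∈ M} f(a|_{S_e}) · x^e` (has the `M`-coefficient vector of a polynomial that) lies in `𝒞`.**
  For `𝒞 = VNP(n,d)` and `f = Perm` this is KRST §3.4 (an exponential sum); for `𝒞 = VP` — the
  tree's `SmallCircuits F n b` — it is the arrow that is NOT in print: `succinctHittingSetsForVP_of_designGenerators`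
  displays the barrier hypothesis `SuccinctHittingSetsForVP F` as (KI hitting property of the design
  generators, the output of KRST Lemma 8 from hardness of `f`) + (their `VP`-succinctness).

**Not here** (this file is the SHAPE only). KRST Lemma 8 is in the tree via ROOT CLOSURE —
`Literature/Computability/AlgebraicComplexity/RootLifting.lean` + `KabanetsImpagliazzoGenerator.lean` +
`KabanetsImpagliazzoHardness.lean` (Kaltofen's factor closure is not needed); the Reed–Solomon design
and the `VNP`-succinctness computation / §3.1–3.5 assembly landed with `KRSTDesign.lean`,
`KRSTSelection.lean`, `KRSTSuccinctness(Bounds).lean`, `AlgebraicNaturalProofsKI.lean`,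
`AlgebraicNaturalProofsKRST.lean` and `AlgebraicNaturalProofsKRSTVNP.lean` (KRST 2022 Main Theorem,
`succinctHittingSetsFromVNP_of_permanentExpHard`, no named-fact hypothesis); FSV Lemma 13 (hitting
set ⇒ generator by a universal circuit) is the summit-side
`Summits/ValiantsHypothesis/ValiantsHypothesis/Theorems/BarrierLeverSuccinctHittingSetsForVPGeneratorEquivalence.lean`
(`succinctHittingSetsForVP_iff_generator`, over `ℂ`, from Raz's universal circuit) and its JOINT form
`…UniversalJoint.lean` (`universalJointness`); the interpolation count of Lemma 14 is not here (only
the infinite-field form is proved). By the ruling of record (D-0053) the `VP` barrier is CONDITIONAL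
on a succinct-generator conjecture (`…Theorems/BarrierLeverSuccinctHittingSetsForVPKRSTDoor.lean`,
refuted for KRST's own design for every `b < 6c`: `…Theorems/BarrierLeverKRSTNoGoBelow6c.lean`), not a
consequence of permanent hardness.

## References

* [ForbesShpilkaVolk2018] M. A. Forbes, A. Shpilka, B. L. Volk, *Succinct hitting sets and barriers to
  proving lower bounds for algebraic circuits*, Theory Comput. 14 (2018) 18:1–45 (arXiv:1701.05328),
  Def. 7, Lemma 13, Lemma 14, Cor. 15, Question 6.
* [KumarRamyaSaptharishiTengse2022] M. Kumar, C. Ramya, R. Saptharishi, A. Tengse, *If VNP is hard,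
  then so are equations for it*, STACS 2022, LIPIcs 219, 44 (arXiv:2012.07056), Def. 5, Def. 7,
  Lemma 8, §3.4–3.5, §4.
* [Burgisser2024Completeness] P. Bürgisser, *Completeness classes in algebraic complexity theory*,
  arXiv:2406.06217, §7.3.
-/

noncomputable section

namespace Literature.Barriers.ValiantsHypothesis

open Literature.Computability.AlgebraicComplexity MvPolynomial

/-! ### Succinct generators (FSV Def. 7; KRST Def. 5) -/

section Generators

variable {F : Type*} [CommSemiring F] {σ τ : Type*} {M : Set (σ →₀ ℕ)}

/-- The output `𝒢(a) = (𝒢_m(a))_{m ∈ M} ∈ F^M` of a polynomial map `G : M → F[τ]` (one polynomial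
in the seed variables `τ` per coordinate `m ∈ M`) at the seed `a ∈ F^τ`.
[cite: ForbesShpilkaVolk2018, Def. 7] -/
def genOutput (G : M → MvPolynomial τ F) (a : τ → F) : M → F :=
  fun m => eval a (G m)

/-- Unfolding of `genOutput`. [cite: ForbesShpilkaVolk2018, Def. 7] -/
@[simp] theorem genOutput_apply (G : M → MvPolynomial τ F) (a : τ → F) (m : M) :
    genOutput G a m = eval a (G m) := rfl

/-- **Hitting set generator** (KRST Def. 5; FSV Def. 7 (3) "`𝒢` is a generator for `𝒟`"): every
nonzero `D ∈ 𝒟` stays nonzero after the substitution `c_m ↦ 𝒢_m(y)`, i.e. `D ∘ 𝒢 ≢ 0` as a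
polynomial in the seed variables (`MvPolynomial.bind₁ G D`).
[cite: KumarRamyaSaptharishiTengse2022, Def. 5] -/
def IsHittingSetGenerator (𝒟 : Set (MvPolynomial M F)) (G : M → MvPolynomial τ F) : Prop :=
  ∀ D ∈ 𝒟, D ≠ 0 → bind₁ G D ≠ 0

/-- **`𝒞`-succinctness of a generator** (FSV Def. 7 (2): "For every value `α ∈ 𝔽^ℓ`, the
polynomial `G(x, α) ∈ 𝒞`", `G(x, y) = Σ_m 𝒢_m(y) x^m`), in coefficient form: every output `𝒢(a)`
is the `M`-coefficient vector of some member of `𝒞` (for `𝒞 ⊆ H(M)`, as in print, that member is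
`G(x, a)` itself). [cite: ForbesShpilkaVolk2018, Def. 7] -/
def IsSuccinctGenerator (M : Set (σ →₀ ℕ)) (𝒞 : Set (MvPolynomial σ F))
    (G : M → MvPolynomial τ F) : Prop :=
  ∀ a : τ → F, ∃ f ∈ 𝒞, coeffVector M f = genOutput G a

/-- `(D ∘ 𝒢)(a) = D(𝒢(a))`: evaluating the composition at a seed is evaluating `D` at the output.
[cite: ForbesShpilkaVolk2018, Def. 7] -/
theorem eval_bind₁_eq_eval_genOutput (G : M → MvPolynomial τ F) (a : τ → F)
    (D : MvPolynomial M F) : eval a (bind₁ G D) = eval (genOutput G a) D :=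
  eval₂Hom_bind₁ _ _ _ _

/-- The converse half of FSV's remark after Def. 7 (any commutative semiring): if the output SET
`{𝒢(a)}` hits every nonzero member of `𝒟`, then `𝒢` is a generator for `𝒟`.
[cite: ForbesShpilkaVolk2018, Def. 7] -/
theorem IsHittingSetGenerator.of_hits {𝒟 : Set (MvPolynomial M F)} {G : M → MvPolynomial τ F}
    (h : ∀ D ∈ 𝒟, D ≠ 0 → ∃ a : τ → F, eval (genOutput G a) D ≠ 0) :
    IsHittingSetGenerator 𝒟 G := by
  intro D hD hD0 hcomp
  obtain ⟨a, ha⟩ := h D hD hD0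
  rw [← eval_bind₁_eq_eval_genOutput, hcomp, map_zero] at ha
  exact ha rfl

/-- A generator for `𝒟` is one for every subclass (immediate from Def. 7 (3)).
[cite: ForbesShpilkaVolk2018, Def. 7] -/
theorem IsHittingSetGenerator.anti {𝒟 𝒟' : Set (MvPolynomial M F)} {G : M → MvPolynomial τ F}
    (h : IsHittingSetGenerator 𝒟 G) (h𝒟 : 𝒟' ⊆ 𝒟) : IsHittingSetGenerator 𝒟' G :=
  fun D hD hD0 => h D (h𝒟 hD) hD0

/-- Succinctness survives enlarging the simple class (immediate from Def. 7 (2)).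
[cite: ForbesShpilkaVolk2018, Def. 7] -/
theorem IsSuccinctGenerator.mono {𝒞 𝒞' : Set (MvPolynomial σ F)} {G : M → MvPolynomial τ F}
    (h : IsSuccinctGenerator M 𝒞 G) (h𝒞 : 𝒞 ⊆ 𝒞') : IsSuccinctGenerator M 𝒞' G :=
  fun a => let ⟨f, hf, hfa⟩ := h a; ⟨f, h𝒞 hf, hfa⟩

end Generators

/-! ### Generators give succinct hitting sets over an infinite field (FSV Lemma 14; KRST §3.5) -/

section Infinite

variable {F : Type*} [Field F] [Infinite F] {σ τ : Type*} {M : Set (σ →₀ ℕ)}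

/-- Over an infinite field a generator hits with some OUTPUT: if `D ∘ 𝒢 ≢ 0` then `D(𝒢(a)) ≠ 0`
for some seed `a` (a nonzero polynomial over an infinite field has a non-root, Mathlib's
`MvPolynomial.funext`; print: "over large enough fields", FSV Lemma 14 with interpolation).
[cite: ForbesShpilkaVolk2018, Lemma 14] -/
theorem IsHittingSetGenerator.exists_eval_genOutput_ne_zero {𝒟 : Set (MvPolynomial M F)}
    {G : M → MvPolynomial τ F} (h : IsHittingSetGenerator 𝒟 G) {D : MvPolynomial M F} (hD : D ∈ 𝒟)
    (hD0 : D ≠ 0) : ∃ a : τ → F, eval (genOutput G a) D ≠ 0 := by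
  by_contra hcon
  push Not at hcon
  exact h D hD hD0 (MvPolynomial.funext fun a => by
    rw [eval_bind₁_eq_eval_genOutput, hcon a, map_zero])

/-- **FSV Lemma 14 (infinite field): a `𝒞`-succinct generator for `𝒟` makes `𝒞` a `𝒞`-succinct
hitting set for `𝒟`** — the step "`P ∘ KI-gen ≢ 0`, hence by the Polynomial Identity Lemma `P` is
nonzero at the coefficient vector of `F^{≤d}(y, a)` for some `a`" of KRST §3.5. This is the door
through which every hardness-to-randomness argument enters the barrier: by FSV Thm. 4
(`exists_isNaturalProof_iff`) its conclusion is the non-existence of `𝒟`-natural proofs against `𝒞`.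
[cite: ForbesShpilkaVolk2018, Lemma 14] -/
theorem isSuccinctHittingSet_of_generator {𝒞 : Set (MvPolynomial σ F)}
    {𝒟 : Set (MvPolynomial M F)} {G : M → MvPolynomial τ F} (hgen : IsHittingSetGenerator 𝒟 G)
    (hsucc : IsSuccinctGenerator M 𝒞 G) : IsSuccinctHittingSet M 𝒞 𝒟 := by
  intro D hD hD0
  obtain ⟨a, ha⟩ := hgen.exists_eval_genOutput_ne_zero hD hD0
  obtain ⟨f, hf, hfa⟩ := hsucc a
  exact ⟨f, hf, by rwa [hfa]⟩

/-- Over an infinite field, "`𝒢` is a generator for `𝒟`" is EQUIVALENT to "the output set of `𝒢`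
hits every nonzero member of `𝒟`" (FSV, remark after Def. 7: "equivalent, over large enough
fields"). [cite: ForbesShpilkaVolk2018, Def. 7] -/
theorem isHittingSetGenerator_iff_hits {𝒟 : Set (MvPolynomial M F)} {G : M → MvPolynomial τ F} :
    IsHittingSetGenerator 𝒟 G ↔ ∀ D ∈ 𝒟, D ≠ 0 → ∃ a : τ → F, eval (genOutput G a) D ≠ 0 :=
  ⟨fun h _ hD hD0 => h.exists_eval_genOutput_ne_zero hD hD0, IsHittingSetGenerator.of_hits⟩

/-- Hence no `𝒟`-natural proof against `𝒞` exists once a `𝒞`-succinct generator for `𝒟` does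
(FSV Lemma 14 with Thm. 4). [cite: ForbesShpilkaVolk2018, Thm. 4 and Lemma 14] -/
theorem not_exists_isNaturalProof_of_generator {𝒞 : Set (MvPolynomial σ F)}
    {𝒟 : Set (MvPolynomial M F)} {G : M → MvPolynomial τ F} (hgen : IsHittingSetGenerator 𝒟 G)
    (hsucc : IsSuccinctGenerator M 𝒞 G) : ¬ ∃ D, IsNaturalProof M 𝒞 𝒟 D := by
  rw [exists_isNaturalProof_iff, not_not]
  exact isSuccinctHittingSet_of_generator hgen hsucc

end Infinite

/-! ### Relative (slice) generators — for the narrowed barrier `AlgebraicNaturalProofsNarrow` -/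

section Relative

variable {F : Type*} [CommSemiring F] {σ τ : Type*} {M : Set (σ →₀ ℕ)}

/-- **Generator relative to a slice `P`**: `𝒢` need only keep nonzero (after composition) those
`D ∈ 𝒟` that are nonzero SOMEWHERE ON `P` — the right notion when all outputs of `𝒢` lie in a
slice (e.g. are multilinear: then `c_m` for non-multilinear `m` annihilates `𝒢` but proves nothing,
FSV §1.2). [cite: ForbesShpilkaVolk2018, Def. 7] -/
def IsHittingSetGeneratorRel (M : Set (σ →₀ ℕ)) (P : Set (MvPolynomial σ F))
    (𝒟 : Set (MvPolynomial M F)) (G : M → MvPolynomial τ F) : Prop :=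
  ∀ D ∈ 𝒟, (∃ g ∈ P, eval (coeffVector M g) D ≠ 0) → bind₁ G D ≠ 0

/-- An absolute generator is a relative one for every slice (a polynomial nonzero somewhere on
`P` is nonzero; Def. 7 (3)). [cite: ForbesShpilkaVolk2018, Def. 7] -/
theorem IsHittingSetGenerator.rel {𝒟 : Set (MvPolynomial M F)} {G : M → MvPolynomial τ F}
    (h : IsHittingSetGenerator 𝒟 G) (P : Set (MvPolynomial σ F)) :
    IsHittingSetGeneratorRel M P 𝒟 G := by
  rintro D hD ⟨g, -, hg⟩
  exact h D hD (by rintro rfl; exact hg (map_zero _))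

end Relative

section RelativeInfinite

variable {F : Type*} [Field F] [Infinite F] {σ τ : Type*} {M : Set (σ →₀ ℕ)}

/-- **Relative FSV Lemma 14**: a generator relative to `P` all of whose outputs are realised by
SIMPLE members of the slice (`𝒞 ∩ P`) makes `𝒞 ∩ P` a relative succinct hitting set
(`IsSuccinctHittingSetRel`), i.e. (relative Thm. 4, `exists_isNaturalProofRel_iff`) excludes
`P`-relative natural proofs against `𝒞`. [cite: ForbesShpilkaVolk2018, Lemma 14] -/
theorem isSuccinctHittingSetRel_of_generator {P 𝒞 : Set (MvPolynomial σ F)}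
    {𝒟 : Set (MvPolynomial M F)} {G : M → MvPolynomial τ F}
    (hgen : IsHittingSetGeneratorRel M P 𝒟 G)
    (hsucc : ∀ a : τ → F, ∃ f ∈ 𝒞, f ∈ P ∧ coeffVector M f = genOutput G a) :
    IsSuccinctHittingSetRel M P 𝒞 𝒟 := by
  intro D hD hP
  have hne := hgen D hD hP
  obtain ⟨a, ha⟩ : ∃ a : τ → F, eval (genOutput G a) D ≠ 0 := by
    by_contra hcon
    push Not at hcon
    exact hne (MvPolynomial.funext fun a => by
      rw [eval_bind₁_eq_eval_genOutput, hcon a, map_zero])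
  obtain ⟨f, hf, hfP, hfa⟩ := hsucc a
  exact ⟨f, hf, hfP, by rwa [hfa]⟩

omit [Infinite F] in
/-- Every point `v ∈ F^M` is matched ON THE VARIABLES OF `D` by a coefficient vector: with
`g = Σ_{m ∈ vars D} v_m x^m` one has `D(coeff_M(g)) = D(v)` (no finiteness of `M` needed — `D`
mentions finitely many coordinates). [folklore] -/
private theorem exists_eval_coeffVector_eq (D : MvPolynomial M F) (v : M → F) :
    ∃ g : MvPolynomial σ F, eval (coeffVector M g) D = eval v D := by
  classical
  refine ⟨∑ m ∈ D.vars, monomial (m : σ →₀ ℕ) (v m), eval₂Hom_congr' rfl (fun m hm _ => ?_) rfl⟩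
  rw [coeffVector_apply, coeff_sum, Finset.sum_eq_single m]
  · rw [coeff_monomial, if_pos rfl]
  · intro m' _ hm'
    rw [coeff_monomial, if_neg fun h => hm' (Subtype.ext h)]
  · exact fun h => (h hm).elim

/-- **The `P = ⊤` equivalence** (recorded as "only the implication is proved" in the scope caveats
of `AlgebraicNaturalProofsNarrow`): over an infinite field the relative hitting property for the
trivial slice IS the absolute one — a nonzero `D` is nonzero at some point of `F^M` (infinite
field), and that point is a coefficient vector on the variables of `D` (`exists_eval_coeffVector_eq`).
[cite: ForbesShpilkaVolk2018, Def. 3] -/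
theorem isSuccinctHittingSetRel_univ_iff {𝒞 : Set (MvPolynomial σ F)}
    {𝒟 : Set (MvPolynomial M F)} :
    IsSuccinctHittingSetRel M Set.univ 𝒞 𝒟 ↔ IsSuccinctHittingSet M 𝒞 𝒟 := by
  refine ⟨fun h D hD hD0 => ?_, IsSuccinctHittingSet.rel_univ⟩
  obtain ⟨v, hv⟩ : ∃ v : M → F, eval v D ≠ 0 := by
    by_contra hcon
    push Not at hcon
    exact hD0 (MvPolynomial.funext fun v => by rw [hcon v, map_zero])
  obtain ⟨g, hg⟩ := exists_eval_coeffVector_eq (σ := σ) D v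
  obtain ⟨f, hf, -, hne⟩ := h D hD ⟨g, Set.mem_univ g, by rwa [hg]⟩
  exact ⟨f, hf, hne⟩

/-- Asymptotic form of the `P = ⊤` equivalence: the relative hypothesis for the trivial slice is
FSV Question 6 itself. [cite: ForbesShpilkaVolk2018, Question 6] -/
theorem succinctHittingSetsForVPRel_univ_iff :
    SuccinctHittingSetsForVPRel F (fun _ => Set.univ) ↔ SuccinctHittingSetsForVP F := by
  refine ⟨fun h a => ?_, succinctHittingSetsForVPRel_univ⟩
  obtain ⟨b, n₀, hb⟩ := h a
  exact ⟨b, n₀, fun n hn => isSuccinctHittingSetRel_univ_iff.1 (hb n hn)⟩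

end RelativeInfinite

/-! ### The asymptotic door in the regime `d = n` -/

section Door

/-- **Succinct hitting-set GENERATORS for `VP`** (FSV Def. 7 at the parameters of Cor. 15 /
Question 6): for every distinguisher level `a` there are a size exponent `b` and `n₀` such that for
every `n ≥ n₀` ONE polynomial map `𝒢` on finitely many seed variables (i) is a generator for
`Distinguishers F n a` (size and degree `≤ N^a`, `N = binom(2n, n)`) and (ii) is
`SmallCircuits F n b`-succinct (every output is the coefficient vector of a degree-`≤ n` polynomial
of circuit size `≤ n^b`). By FSV Lemmas 13–14 this is EQUIVALENT over large fields to Question 6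
(the implication is `succinctHittingSetsForVP_of_generators`; the converse needs a universal circuit
and is proved summit-side over `ℂ`); like Question 6 it is OPEN — a hypothesis, not a theorem.
[cite: ForbesShpilkaVolk2018, Def. 7 and Cor. 15] -/
def SuccinctGeneratorsForVP (F : Type*) [Field F] [Infinite F] : Prop :=
  ∀ a : ℕ, ∃ b n₀ : ℕ, ∀ n : ℕ, n₀ ≤ n → ∃ (ℓ : ℕ) (G : degLEMonomials n → MvPolynomial (Fin ℓ) F),
    IsHittingSetGenerator (Distinguishers F n a) G ∧ IsSuccinctGenerator (degLEMonomials n) (SmallCircuits F n b) G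

variable {F : Type*} [Field F] [Infinite F]

/-- **The door (FSV Lemma 14, asymptotic):** succinct generators for `VP` give succinct hitting sets
for `VP` — FSV Question 6 answered "yes", hence (`algebraicNaturalProofs_holds`) no algebraically
natural proof of any level against `VP`. [cite: ForbesShpilkaVolk2018, Lemma 14 and Cor. 15] -/
theorem succinctHittingSetsForVP_of_generators (h : SuccinctGeneratorsForVP F) :
    SuccinctHittingSetsForVP F := by
  intro a
  obtain ⟨b, n₀, hb⟩ := h a
  refine ⟨b, n₀, fun n hn => ?_⟩
  obtain ⟨ℓ, G, hgen, hsucc⟩ := hb n hn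
  exact isSuccinctHittingSet_of_generator hgen hsucc

/-- **Relative door:** slice-succinct relative generators give the `P`-relative hypothesis
`SuccinctHittingSetsForVPRel F P` of the narrowed barrier (so, by `not_naturalProofAgainstVPRel`,
no `P`-relative natural proof for targets in `P`). [cite: ForbesShpilkaVolk2018, Lemma 14] -/
theorem succinctHittingSetsForVPRel_of_generators {P : ∀ n, Set (MvPolynomial (Fin n) F)}
    (h : ∀ a : ℕ, ∃ b n₀ : ℕ, ∀ n : ℕ, n₀ ≤ n →
      ∃ (ℓ : ℕ) (G : degLEMonomials n → MvPolynomial (Fin ℓ) F),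
        IsHittingSetGeneratorRel (degLEMonomials n) (P n) (Distinguishers F n a) G ∧
          ∀ a' : Fin ℓ → F, ∃ f ∈ SmallCircuits F n b, f ∈ P n ∧
            coeffVector (degLEMonomials n) f = genOutput G a') :
    SuccinctHittingSetsForVPRel F P := by
  intro a
  obtain ⟨b, n₀, hb⟩ := h a
  refine ⟨b, n₀, fun n hn => ?_⟩
  obtain ⟨ℓ, G, hgen, hsucc⟩ := hb n hn
  exact isSuccinctHittingSetRel_of_generator hgen hsucc

end Door

/-! ### The Kabanets–Impagliazzo shape of KRST's generator and the isolated succinctness arrow -/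

section Design

variable {F : Type*} [CommSemiring F] {σ τ ρ : Type*} {M : Set (σ →₀ ℕ)}

/-- **The design generator `KI-gen(f)`** (KRST eq. (KI) / Lemma 8; Nisan–Wigderson,
Kabanets–Impagliazzo): from ONE `ρ`-variate polynomial `f` and a set system `S : M → (ρ → τ)`
assigning to each coordinate `e ∈ M` the seed variables `S e : ρ → τ` it reads (in print `S_e ⊆ [ℓ]`,
`|S_e| = m`, an `(ℓ, m, n)`-design), the polynomial map `e ↦ f(y|_{S_e}) = rename (S e) f`.
[cite: KumarRamyaSaptharishiTengse2022, Lemma 8] -/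
def designGenerator (f : MvPolynomial ρ F) (S : M → ρ → τ) : M → MvPolynomial τ F :=
  fun e => rename (S e) f

/-- Unfolding of `designGenerator`. [cite: KumarRamyaSaptharishiTengse2022, Lemma 8] -/
@[simp] theorem designGenerator_apply (f : MvPolynomial ρ F) (S : M → ρ → τ) (e : M) :
    designGenerator f S e = rename (S e) f := rfl

/-- The output of `KI-gen(f)` at the seed `a`: coordinate `e` is `f(a ∘ S_e)` — `f` evaluated at
the seed entries selected by `S_e`. [cite: KumarRamyaSaptharishiTengse2022, Lemma 8] -/
theorem genOutput_designGenerator (f : MvPolynomial ρ F) (S : M → ρ → τ) (a : τ → F) (e : M) :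
    genOutput (designGenerator f S) a e = eval (a ∘ S e) f := by
  rw [genOutput_apply, designGenerator_apply, eval_rename]

/-- **The succinctness arrow, unfolded.** `KI-gen(f)` is `𝒞`-succinct iff for every seed `a` some
member of `𝒞` has `M`-coefficients `coeff_e = f(a|_{S_e})` — i.e. (for `𝒞 ⊆ H(M)`) the polynomial
`Σ_{e ∈ M} f(a|_{S_e}) · x^e` lies in `𝒞`. KRST §3.4 prove this for `𝒞 = VNP(n,d)`, `f` the
permanent and `S` the Reed–Solomon design (`F^{≤d}_{n,a,p}(y, a)`, an exponential sum); for
`𝒞 = SmallCircuits F n b` (`VP`) it is the step their proof "does not appear to extend to"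
(§1.2, §4 open problem 1). [cite: KumarRamyaSaptharishiTengse2022, §3.4 and §4] -/
theorem isSuccinctGenerator_designGenerator_iff (f : MvPolynomial ρ F) (S : M → ρ → τ)
    (𝒞 : Set (MvPolynomial σ F)) :
    IsSuccinctGenerator M 𝒞 (designGenerator f S) ↔
      ∀ a : τ → F, ∃ g ∈ 𝒞, ∀ e : M, coeff (e : σ →₀ ℕ) g = eval (a ∘ S e) f := by
  refine forall_congr' fun a => exists_congr fun g => and_congr_right fun _ => ?_
  rw [funext_iff]
  exact forall_congr' fun e => by rw [coeffVector_apply, genOutput_designGenerator]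

end Design

section DesignDoor

variable {F : Type*} [Field F] [Infinite F] {σ τ ρ : Type*} {M : Set (σ →₀ ℕ)}

/-- **KRST's argument, abstract form (§3.5):** if `KI-gen(f)` is a hitting set generator for `𝒟`
(their Lemma 8, from hardness of `f`) and is `𝒞`-succinct (their §3.4 for `𝒞 = VNP`), then `𝒞` is
a succinct hitting set for `𝒟` — "`𝒟` has `𝒞`-succinct hitting sets", Def. 6 — and so (Thm. 4) no
member of `𝒟` is an equation for `𝒞`. [cite: KumarRamyaSaptharishiTengse2022, §3.5] -/
theorem isSuccinctHittingSet_of_designGenerator {f : MvPolynomial ρ F} {S : M → ρ → τ}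
    {𝒞 : Set (MvPolynomial σ F)} {𝒟 : Set (MvPolynomial M F)}
    (hgen : IsHittingSetGenerator 𝒟 (designGenerator f S))
    (hsucc : ∀ a : τ → F, ∃ g ∈ 𝒞, ∀ e : M, coeff (e : σ →₀ ℕ) g = eval (a ∘ S e) f) :
    IsSuccinctHittingSet M 𝒞 𝒟 :=
  isSuccinctHittingSet_of_generator hgen ((isSuccinctGenerator_designGenerator_iff f S 𝒞).2 hsucc)

/-- **The `VP` barrier hypothesis through the KI door.** If for every level `a` there are `b, n₀`
and, for each `n ≥ n₀`, a polynomial `f` (in print: a padded permanent `Perm_[p]`, hard by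
assumption), seed variables and a set system `S` such that (i) `KI-gen(f)` is a hitting set
generator for `Distinguishers F n a` — the output of KRST Lemma 8 under `2^{m^ε}`-hardness of `f` —
and (ii) `KI-gen(f)` is `VP`-succinct: every `Σ_e f(a|_{S_e}) x^e` has degree `≤ n` and circuit
size `≤ n^b`, then `SuccinctHittingSetsForVP F` (FSV Question 6) holds, and with it the full
algebraic natural proofs barrier for `VP` (`algebraicNaturalProofs_holds`). Arrow (i) is
Kabanets–Impagliazzo; arrow (ii) is the one not in print for `VP` (KRST §4, Bürgisser 2024 §7.3).
[cite: KumarRamyaSaptharishiTengse2022, Lemma 8 and §3.5] -/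
theorem succinctHittingSetsForVP_of_designGenerators
    (h : ∀ a : ℕ, ∃ b n₀ : ℕ, ∀ n : ℕ, n₀ ≤ n →
      ∃ (m ℓ : ℕ) (f : MvPolynomial (Fin m) F) (S : degLEMonomials n → Fin m → Fin ℓ),
        IsHittingSetGenerator (Distinguishers F n a) (designGenerator f S) ∧
          ∀ y : Fin ℓ → F, ∃ g ∈ SmallCircuits F n b,
            ∀ e : degLEMonomials n, coeff (e : Fin n →₀ ℕ) g = eval (y ∘ S e) f) :
    SuccinctHittingSetsForVP F := by
  refine succinctHittingSetsForVP_of_generators fun a => ?_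
  obtain ⟨b, n₀, hb⟩ := h a
  refine ⟨b, n₀, fun n hn => ?_⟩
  obtain ⟨m, ℓ, f, S, hgen, hsucc⟩ := hb n hn
  exact ⟨ℓ, designGenerator f S, hgen, (isSuccinctGenerator_designGenerator_iff f S _).2 hsucc⟩

end DesignDoor

end Literature.Barriers.ValiantsHypothesis

end
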